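import Summits.QuantumAdvantage.QuantumAdvantage.Theorems.CubicForrelationNearExactIsExactTwelveLevelSixEightPrep751

/-!
# Crux `CubicForrelation.NearExactIsExact` (stmt-QuantumAdvantage-14043) — n = 12, level ≥ 6, branch "`8 ∣ e` off the 9-flat": gen 16's
  preliminaries packaged for budgets `Σ e² ≤ B ≤ 768` UNDER THE HYPOTHESIS `#L ≤ 31` (`λ` even on `Z`, flat ℓ¹ bound `Σ_y |W(σ·1_Z)(y)| ≤ 8192`)

Certificate seat `b2b-cforr-cert` (gen 23).  HONEST FRAMING: a packaging lemma (standard axioms) — `tw20_levelSix_eight_prep767` (gen 20) VERBATIM except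
that the bound `#L ≤ 31` on `L = {x ∈ Z : λ(x) odd}` is now a HYPOTHESIS instead of a consequence of `B ≤ 767` (at the boundary budget `B = 768` it
holds unless `E_off = 0` and `#L = 32`, the configuration (δ₀) of HOME/b2b-cforr-cert-g23/PLAN-N12-928-L6.md); exported for the ℓ¹ engine at `B ≤ 768`
(…TwelveLevelSixEight768).  NOT summit progress.

References: Ax (1964) / McEliece (1972); MacWilliams–Sloane (1977) Ch. 13–15; Carlet (2021) §5.2.  Axioms: standard.
-/

set_option linter.dupNamespace false -- D-0017: single-problem summit ⇒ `QuantumAdvantage.QuantumAdvantage` by design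

noncomputable section

namespace Summit.QuantumAdvantage.QuantumAdvantage.Theorems.CubicForrelation.NearExactIsExact

open Finset
open Literature.Computability.QuantumComplexity
open Literature.Computability.QuantumComplexity.BuzetChailloux (bxor zeroVec bxor_bxor_cancel_left bxor_zeroVec zeroVec_bxor bxor_comm
  bxor_self)
open Literature.Computability.QuantumComplexity.DerivativeWalsh (W)

/-- **Preliminaries of the `8 ∣ e` branch at budget `≤ 768` with `#L ≤ 31`**: `λ = (e − σ)/4` is even on `Z`, and `Σ_y |W(σ·1_Z)(y)| ≤ 8192`.  See the module
docstring. [this work; gen 16's argument] -/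

theorem tw23_levelSix_eight_prep768 (B : ℤ) (f g : (Fin (6 + 6) → Bool) → Bool) (hf : IsDegLeFun 3 f) (hg : IsDegLeFun 3 g)
    (u'' : (Fin (6 + 6) → Bool) → ℤ) (hu'' : ∀ x, W (fun y => signOf (g y)) x = (2 : ℝ) ^ 6 * (u'' x : ℝ))
    (hB_le : (∑ x, (u'' x - sZ (f x)) ^ 2 : ℤ) ≤ B)
    (V₀ : Finset (Fin (6 + 6) → Bool)) (xZ : Fin (6 + 6) → Bool) (h0 : zeroVec ∈ V₀)
    (hadd : ∀ a ∈ V₀, ∀ b ∈ V₀, bxor a b ∈ V₀) (hcardV : #V₀ = 512)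
    (hS : (univ.filter fun x : Fin (6 + 6) → Bool => ¬ Odd (u'' x)) = V₀.image (bxor xZ))
    (hoff8 : ∀ y, y ∉ (univ.filter fun x : Fin (6 + 6) → Bool => ¬ Odd (u'' x)) → (8 : ℤ) ∣ u'' y - sZ (f y))
    (hL31 : #((univ.filter fun x : Fin (6 + 6) → Bool => ¬ Odd (u'' x)).filter fun x =>
      Odd ((u'' x - sZ (f x) - sZ (decide ((u'' x - sZ (f x)) % 4 = 3))) / 4)) ≤ 31) :
    (∀ x ∈ (univ.filter fun x : Fin (6 + 6) → Bool => ¬ Odd (u'' x)),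
        Even ((u'' x - sZ (f x) - sZ (decide ((u'' x - sZ (f x)) % 4 = 3))) / 4)) ∧
      ∑ y, |W (fun x => if x ∈ (univ.filter fun x : Fin (6 + 6) → Bool => ¬ Odd (u'' x))
        then ((sZ (decide ((u'' x - sZ (f x)) % 4 = 3)) : ℤ) : ℝ) else 0) y| ≤ 8192 := by
  classical
  set u : (Fin (6 + 6) → Bool) → ℤ := fun x => 4 * u'' x with hudef
  have hu : ∀ x, W (fun y => signOf (g y)) x = (2 : ℝ) ^ 4 * (u x : ℝ) := by
    intro x; rw [hu'' x]; simp only [u]; push_cast; ring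
  set e : (Fin (6 + 6) → Bool) → ℤ := fun x => u'' x - sZ (f x) with hedef
  change (∑ x, e x ^ 2 : ℤ) ≤ B at hB_le
  have hFe : ∀ y, u y - 4 * sZ (f y) = 4 * e y := fun y => by simp only [u, e]; ring
  set Z := univ.filter (fun x : Fin (6 + 6) → Bool => ¬ Odd (u'' x)) with hZdef
  have hmemZ : ∀ x, x ∈ Z ↔ ¬ Odd (u'' x) := fun x => by simp [hZdef]
  change ∀ y, y ∉ Z → (8 : ℤ) ∣ e y at hoff8
  have heodd : ∀ x, x ∈ Z → Odd (e x) := by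
    intro x hx
    have hev := Int.not_odd_iff_even.1 ((hmemZ x).1 hx)
    rcases tp_sZ_cases (f x) with hs | hs <;> simp only [e] <;> rw [hs]
    · exact Int.odd_sub.2 (iff_of_false (Int.not_odd_iff_even.2 hev) (by decide))
    · exact Int.odd_sub.2 (iff_of_false (Int.not_odd_iff_even.2 hev) (by decide))
  have hsq1 : ∀ x, x ∈ Z → 1 ≤ e x ^ 2 := by
    intro x hx
    have h0 := Int.odd_iff.1 (heodd x hx)
    have : e x ≤ -1 ∨ 1 ≤ e x := by omega
    have := tp_sq_ge (k := 1) (by norm_num) this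
    linarith
  have hsplit : (∑ x, e x ^ 2 : ℤ) = ∑ x ∈ Z, e x ^ 2 + ∑ x ∈ univ.filter (fun x => x ∉ Z), e x ^ 2 := by
    rw [← sum_filter_add_sum_filter_not univ (fun x => x ∈ Z)]
    congr 1
    exact sum_congr (by ext x; simp) fun _ _ => rfl
  have hpar : ∑ x, u'' x ^ 2 = 4096 := by
    have h := zms_sum_u_sq 2 g u (fun x => (hu x).trans (by norm_num))
    have e : ∑ x, ((u x : ℝ)) ^ 2 = 16 * ∑ x, ((u'' x : ℝ)) ^ 2 := by
      rw [mul_sum]; exact sum_congr rfl fun x _ => by simp only [u]; push_cast; ring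
    rw [e] at h
    norm_num at h
    have h' : ∑ x, ((u'' x : ℝ)) ^ 2 = 4096 := by linarith
    exact_mod_cast h'
  have hZcard : #Z = 512 := by
    rw [hS, card_image_of_injective _ (fun a b h => by simpa using congrArg (bxor xZ) h), hcardV]
  have hcardV9 : #V₀ = 2 ^ 9 := by rw [hcardV]; norm_num
  have hxZ : xZ ∈ Z := by rw [hS]; exact mem_image.2 ⟨zeroVec, h0, bxor_zeroVec xZ⟩
  have hPV : ∀ x, x ∈ Z → ∀ a ∈ V₀, bxor x a ∈ Z := fun x hx a ha => fl1_coset_vadd hadd hS hx ha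
  have hon_le : ∑ x ∈ Z, (e x ^ 2 - 1) ≤ B - 512 := by
    rw [sum_sub_distrib, sum_const, nsmul_eq_mul, mul_one, hZcard]
    have h3 : 0 ≤ ∑ x ∈ univ.filter (fun x => x ∉ Z), e x ^ 2 := sum_nonneg fun x _ => sq_nonneg _
    push_cast
    linarith
  obtain ⟨H3, H4⟩ := tw6_H34_tol f g hf hg u'' hu'' V₀ xZ h0 hadd hcardV hS hoff8
  replace H3 : ∀ x ∈ Z, ∀ a b c : Fin (6 + 6) → Bool, a ∈ V₀ → b ∈ V₀ → c ∈ V₀ →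
      (4 : ℤ) ∣ ∑ ε : Fin 3 → Bool, e (fun j => x j ^^ decide (Odd #(univ.filter fun i =>
        ε i && (![a, b, c] : Fin 3 → Fin (6 + 6) → Bool) i j))) := H3
  replace H4 : ∀ x ∈ Z, ∀ a₀ a₁ a₂ a₃ : Fin (6 + 6) → Bool, a₀ ∈ V₀ → a₁ ∈ V₀ → a₂ ∈ V₀ → a₃ ∈ V₀ →
      (8 : ℤ) ∣ ∑ ε : Fin 4 → Bool, e (fun j => x j ^^ decide (Odd #(univ.filter fun i =>
        ε i && (![a₀, a₁, a₂, a₃] : Fin 4 → Fin (6 + 6) → Bool) i j))) := H4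
  set hb : (Fin (6 + 6) → Bool) → Bool := fun x => decide (e x % 4 = 3) with hhb
  set lam : (Fin (6 + 6) → Bool) → ℤ := fun x => (e x - sZ (hb x)) / 4 with hlam
  have hdec : ∀ x, x ∈ Z → e x = sZ (hb x) + 4 * lam x := by
    intro x hx
    have h0 := Int.odd_iff.1 (heodd x hx)
    have hmod : e x % 4 = 1 ∨ e x % 4 = 3 := by omega
    have h4 : (4 : ℤ) ∣ e x - sZ (hb x) := by
      rcases hmod with h1 | h3
      · have hsz : sZ (hb x) = 1 := by simp [hb, h1, sZ]
        rw [hsz]; omega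
      · have hsz : sZ (hb x) = -1 := by simp [hb, h3, sZ]
        rw [hsz]; omega
    have := Int.mul_ediv_cancel' h4
    simp only [lam]
    linarith
  have H3σ : ∀ x, x ∈ Z → ∀ a b c : Fin (6 + 6) → Bool, a ∈ V₀ → b ∈ V₀ → c ∈ V₀ →
      (4 : ℤ) ∣ ∑ ε : Fin 3 → Bool, sZ (hb (fun j => x j ^^ decide (Odd #(univ.filter fun i =>
        ε i && (![a, b, c] : Fin 3 → Fin (6 + 6) → Bool) i j)))) := by
    intro x hx a b c ha hb' hc
    have hin : ∀ ε : Fin 3 → Bool, (fun j => x j ^^ decide (Odd #(univ.filter fun i =>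
        ε i && (![a, b, c] : Fin 3 → Fin (6 + 6) → Bool) i j))) ∈ Z :=
      fun ε => fr_mem_flatPt3 V₀ h0 (· ∈ Z) hPV hx ![a, b, c] (fun i => by fin_cases i <;> assumption) ε
    have h := H3 x hx a b c ha hb' hc
    rw [sum_congr rfl fun ε _ => hdec _ (hin ε), sum_add_distrib, ← mul_sum] at h
    obtain ⟨k, hk⟩ := h
    exact ⟨k - ∑ ε : Fin 3 → Bool, lam (fun j => x j ^^ decide (Odd #(univ.filter fun i =>
        ε i && (![a, b, c] : Fin 3 → Fin (6 + 6) → Bool) i j))), by linarith⟩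
  have hVP : ∀ x, x ∈ Z → bxor xZ x ∈ V₀ := fun x hx => fl1_coset_diff hS hx
  have hsd := fr_hsd V₀ (· ∈ Z) xZ hxZ hVP hb H3σ
  have hPf : ∀ x, x ∈ Z → ∀ a : Fin 4 → Fin (6 + 6) → Bool, (∀ i, a i ∈ V₀) →
      ((2 : ℤ) ∣ ∑ ε : Fin 4 → Bool, lam (fun j => x j ^^ decide (Odd #(univ.filter fun i => ε i && a i j))) ↔
        ¬ ((((hb xZ ^^ hb (bxor xZ (a 1)) ^^ hb (bxor xZ (a 0)) ^^ hb (bxor (bxor xZ (a 1)) (a 0))) &&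
            (hb xZ ^^ hb (bxor xZ (a 3)) ^^ hb (bxor xZ (a 2)) ^^ hb (bxor (bxor xZ (a 3)) (a 2)))) ^^
          ((hb xZ ^^ hb (bxor xZ (a 2)) ^^ hb (bxor xZ (a 0)) ^^ hb (bxor (bxor xZ (a 2)) (a 0))) &&
            (hb xZ ^^ hb (bxor xZ (a 3)) ^^ hb (bxor xZ (a 1)) ^^ hb (bxor (bxor xZ (a 3)) (a 1)))) ^^
          ((hb xZ ^^ hb (bxor xZ (a 3)) ^^ hb (bxor xZ (a 0)) ^^ hb (bxor (bxor xZ (a 3)) (a 0))) &&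
            (hb xZ ^^ hb (bxor xZ (a 2)) ^^ hb (bxor xZ (a 1)) ^^ hb (bxor (bxor xZ (a 2)) (a 1))))) = true)) := by
    intro x hx a ha
    have ea : a = ![a 0, a 1, a 2, a 3] := by funext i; fin_cases i <;> rfl
    have hin : ∀ ε : Fin 4 → Bool, (fun j => x j ^^ decide (Odd #(univ.filter fun i => ε i && a i j))) ∈ Z :=
      fun ε => fr_mem_flatPt4 V₀ h0 (· ∈ Z) hPV hx a ha ε
    have h8 := H4 x hx (a 0) (a 1) (a 2) (a 3) (ha 0) (ha 1) (ha 2) (ha 3)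
    rw [← ea] at h8
    rw [sum_congr rfl fun ε _ => hdec _ (hin ε), sum_add_distrib, ← mul_sum] at h8
    have hm8 := ws_sum4_mod8 V₀ (· ∈ Z) xZ hb hPV hsd hx (ha 0) (ha 1) (ha 2) (ha 3)
    rw [← ea] at hm8
    constructor
    · intro h2 hpf
      rw [if_pos hpf] at hm8; obtain ⟨k, hk⟩ := h8; obtain ⟨k2, hk2⟩ := h2; omega
    · intro hpf
      rw [if_neg hpf] at hm8
      obtain ⟨k, hk⟩ := h8
      exact ⟨k - (∑ ε : Fin 4 → Bool, sZ (hb (fun j => x j ^^ decide (Odd #(univ.filter fun i =>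
        ε i && a i j))))) / 8, by omega⟩
  set L := Z.filter (fun x => Odd (lam x)) with hLdef
  have hcost8 : ∀ x, x ∈ Z → Odd (lam x) → 8 ≤ e x ^ 2 - 1 := by
    intro x hx hodd
    have hd := hdec x hx
    have h0 := Int.odd_iff.1 hodd
    rcases tp_sZ_cases (hb x) with hs | hs <;> rw [hs] at hd
    · have : e x ≤ -3 ∨ 3 ≤ e x := by omega
      have := tp_sq_ge (k := 3) (by norm_num) this; linarith
    · have : e x ≤ -3 ∨ 3 ≤ e x := by omega
      have := tp_sq_ge (k := 3) (by norm_num) this; linarith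
  have hL7 : (#L : ℤ) ≤ 31 := by exact_mod_cast hL31
  have hLeven : ∀ x, x ∈ Z → ∀ a : Fin 4 → Fin (6 + 6) → Bool, (∀ i, a i ∈ V₀) →
      (2 : ℤ) ∣ ∑ ε : Fin 4 → Bool, lam (fun j => x j ^^ decide (Odd #(univ.filter fun i => ε i && a i j))) := by
    intro x hx a ha
    by_contra hodd
    have hPfa := fun hn => hodd ((hPf x hx a ha).2 hn)
    have hall : ∀ y, y ∈ Z → ¬ (2 : ℤ) ∣ ∑ ε : Fin 4 → Bool, lam (fun j => y j ^^ decide (Odd #(univ.filter fun i =>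
        ε i && a i j))) := fun y hy h2 => (hPf y hy a ha).1 h2 (not_not.1 hPfa)
    have hex : ∀ y, y ∈ Z → ∃ ε : Fin 4 → Bool, Odd (lam (fun j => y j ^^ decide (Odd #(univ.filter fun i =>
        ε i && a i j)))) := by
      intro y hy; by_contra hnone; push Not at hnone
      exact hall y hy (dvd_sum fun ε _ => even_iff_two_dvd.1 (Int.not_odd_iff_even.1 (hnone ε)))
    have hv : ∀ ε : Fin 4 → Bool, (fun j => zeroVec j ^^ decide (Odd #(univ.filter fun i => ε i && a i j))) ∈ V₀ :=
      fun ε => ws_flatPt_mem V₀ h0 (· ∈ V₀) (fun y hy b hb' => hadd y hy b hb') 4 zeroVec h0 a ha ε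
    have hcover : Z ⊆ (univ : Finset (Fin 4 → Bool)).biUnion (fun ε => Z.filter fun y =>
        Odd (lam (bxor y (fun j => zeroVec j ^^ decide (Odd #(univ.filter fun i => ε i && a i j)))))) := by
      intro y hy; obtain ⟨ε, hε⟩ := hex y hy; rw [ws_flatPt_eq_bxor] at hε
      exact mem_biUnion.2 ⟨ε, mem_univ _, mem_filter.2 ⟨hy, hε⟩⟩
    have hcard := (card_le_card hcover).trans card_biUnion_le
    rw [sum_congr rfl fun ε _ => ws_card_translate V₀ Z xZ hadd hS (hv ε) (fun y => Odd (lam y)), sum_const, card_univ,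
      Fintype.card_fun, Fintype.card_bool, Fintype.card_fin, smul_eq_mul, hZcard] at hcard
    have : (512 : ℤ) ≤ 16 * #L := by exact_mod_cast hcard
    linarith
  have hlam_even : ∀ x, x ∈ Z → Even (lam x) := by
    rcases ws_erm_round V₀ h0 hadd hcardV9 xZ lam 3 (fun b hb' a ha => hLeven b (by rwa [hS]) a ha) with hev | hbig
    · intro x hx; exact hev x (by rwa [← hS])
    · exfalso
      rw [← hS] at hbig
      have hbig' : 2 ^ 9 ≤ 2 ^ 3 * #L := hbig
      have : (64 : ℤ) ≤ #L := by exact_mod_cast (by norm_num at hbig'; omega)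
      linarith
  have hσpm : ∀ x ∈ Z, sZ (hb x) = 1 ∨ sZ (hb x) = -1 := fun x _ => tp_sZ_cases _
  have H3σ' : ∀ x ∈ Z, ∀ a b c : Fin (6 + 6) → Bool, a ∈ V₀ → b ∈ V₀ → c ∈ V₀ →
      (4 : ℤ) ∣ ∑ ε : Fin 3 → Bool, sZ (hb (fun j => x j ^^ decide (Odd #(univ.filter fun i =>
        ε i && (![a, b, c] : Fin 3 → Fin (6 + 6) → Bool) i j)))) := fun x hx a b c ha hb' hc => H3σ x hx a b c ha hb' hc
  have H4σ : ∀ x ∈ Z, ∀ a₀ a₁ a₂ a₃ : Fin (6 + 6) → Bool, a₀ ∈ V₀ → a₁ ∈ V₀ → a₂ ∈ V₀ → a₃ ∈ V₀ →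
      (8 : ℤ) ∣ ∑ ε : Fin 4 → Bool, sZ (hb (fun j => x j ^^ decide (Odd #(univ.filter fun i =>
        ε i && (![a₀, a₁, a₂, a₃] : Fin 4 → Fin (6 + 6) → Bool) i j)))) := by
    intro x hx a₀ a₁ a₂ a₃ ha₀ ha₁ ha₂ ha₃
    have hin : ∀ ε : Fin 4 → Bool, (fun j => x j ^^ decide (Odd #(univ.filter fun i =>
        ε i && (![a₀, a₁, a₂, a₃] : Fin 4 → Fin (6 + 6) → Bool) i j))) ∈ Z :=
      fun ε => fr_mem_flatPt4 V₀ h0 (· ∈ Z) hPV hx ![a₀, a₁, a₂, a₃] (fun i => by fin_cases i <;> assumption) ε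
    have h8 := H4 x hx a₀ a₁ a₂ a₃ ha₀ ha₁ ha₂ ha₃
    rw [sum_congr rfl fun ε _ => hdec _ (hin ε), sum_add_distrib, ← mul_sum] at h8
    have h2 : (2 : ℤ) ∣ ∑ ε : Fin 4 → Bool, lam (fun j => x j ^^ decide (Odd #(univ.filter fun i =>
        ε i && (![a₀, a₁, a₂, a₃] : Fin 4 → Fin (6 + 6) → Bool) i j))) :=
      dvd_sum fun ε _ => even_iff_two_dvd.1 (hlam_even _ (hin ε))
    obtain ⟨k, hk⟩ := h8
    obtain ⟨k2, hk2⟩ := h2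
    exact ⟨k - k2, by linarith⟩
  have hE := fl1_flat_l1 V₀ Z xZ h0 hadd hS (fun x => sZ (hb x)) hσpm H3σ' H4σ
  set A : (Fin (6 + 6) → Bool) → ℝ := fun x => if x ∈ Z then ((sZ (hb x) : ℤ) : ℝ) else 0 with hA
  have hl1 : ∑ y, |W A y| ≤ 8192 := by
    by_contra hgt
    push Not at hgt
    have hsq : (8192 : ℝ) ^ 2 < (∑ y, |W A y|) ^ 2 := pow_lt_pow_left₀ hgt (by norm_num) two_ne_zero
    norm_num at hE hsq
    linarith

  exact ⟨hlam_even, hl1⟩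

end Summit.QuantumAdvantage.QuantumAdvantage.Theorems.CubicForrelation.NearExactIsExact

end
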